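import Summits.Langlands.Langlands.Theses.TwistAveragedDeinduction

/-!
# Birth skeleton — piece `InducedAutomorphyOverQ` of the decomposition of `AJunction`
(route TwistAveragedDeinduction, parent crux stmt-Langlands-16013; strategist planner-cstrat-stmt-Langlands-16013-r1-0)

Three registered stubs and the kernel-checked composition `InducedAutomorphyOverQ_of`:
`stub_induceGeometric` (Galois induction of an irreducible geometric `ρ` over `F` to `ℚ`: semisimple,
unramified a.e., de Rham above ℓ for the pinned datum, induced Frobenius polynomials — tree
`FramedGaloisRep.induce`, `exists_charpoly_induce_eq_prod`, `isUnramifiedAt_induce`),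
`stub_automorphiseSemisimple` ((B)_ℚ of `LanglandsOverQ` on the irreducible constituents + isobaric
sum, with L-algebraic output matching the Frobenius polynomials a.e.), `stub_dictionary` (the
ℚ̄_ℓ ↔ ℂ dictionary `a ↦ ι⁻¹(a⁻¹)` commutes with `X ↦ X^f`: a Frobenius-side product identity is a
Satake-side one).  Sorries ONLY inside `stub_*`.
-/

namespace Summit.Langlands.Langlands.Cruxes.AJunction.BirthInducedAutomorphyOverQ

open scoped BigOperators Topology Manifold Classical MeasureTheory ProbabilityTheory Matrix InnerProductSpace ComplexConjugate ContinuousMap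
open Filter Set Function TopologicalSpace MeasureTheory
open Summit.Langlands.Langlands.Theses.TwistAveragedDeinduction

/-- The piece, verbatim (child `InducedAutomorphyOverQ` of `AJunction`; not yet a route decl). -/
def InducedAutomorphyOverQ : Prop :=
  LanglandsOverQ → ∀ (F : Type) [Field F] [NumberField F] (n : ℕ), 0 < n → ∀ (ℓ : ℕ) [Fact ℓ.Prime] (ι : PadicAlgCl ℓ ≃+* ℂ) (ρ : Literature.NumberTheory.GaloisRepresentations.FramedGaloisRep F (PadicAlgCl ℓ) n), ρ.toGaloisRep.IsIrreducible → (∀ᶠ w : IsDedekindDomain.HeightOneSpectrum (NumberField.RingOfIntegers F) in cofinite, ρ.IsUnramifiedAt w) → (∀ (w : IsDedekindDomain.HeightOneSpectrum (NumberField.RingOfIntegers F)) (hw : ((ℓ : ℕ) : NumberField.RingOfIntegers F) ∈ w.asIdeal), (Literature.NumberTheory.PAdicHodge.fontainePstAdicCompletion w ℓ hw).IsDeRhamFramed (ρ.toLocal w)) → ∃ (hQ : Literature.NumberTheory.Automorphic.isCompact_glFiniteIntegralLevel (n * Module.finrank ℚ F) ℚ) (P : Literature.NumberTheory.Automorphic.AutomorphicRepData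 (Literature.NumberTheory.Automorphic.AutomorphyDatum.gl (n * Module.finrank ℚ F) ℚ hQ)), P.IsLAlgebraic ∧ ∀ᶠ v : IsDedekindDomain.HeightOneSpectrum (NumberField.RingOfIntegers ℚ) in cofinite, ∀ β : IsDedekindDomain.HeightOneSpectrum (NumberField.RingOfIntegers F) → Multiset ℂ, (∀ w : IsDedekindDomain.HeightOneSpectrum (NumberField.RingOfIntegers F), w.asIdeal.under (NumberField.RingOfIntegers ℚ) = v.asIdeal → ρ.IsUnramifiedAt w ∧ ρ.HasFrobCharpolyAt w (Literature.NumberTheory.Automorphic.arithFrobPolyOfSatake ι w.residueCard 1 (β w))) → ∃ α : Multiset ℂ, P.HasSatakeParamAt v α ∧ Literature.NumberTheory.Automorphic.satakePolynomial α = ∏ᶠ w ∈ {w : IsDedekindDomain.HeightOneSpectrum (NumberField.RingOfIntegers F) | w.asIdeal.under (NumberField.RingOfIntegers ℚ) = v.asIdeal}, (Literature.NumberTheory.Automorphic.satakePolynomial (β w)).comp (Polynomial.X ^ w.asIdeal.inertiaDeg (NumberField.RingOfIntegers ℚ))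

/-- **stub_induceGeometric** (L): `R := Ind_(Γ_F)^(Γ_ℚ) ρ` is semisimple, unramified a.e., de Rham
above ℓ for ℚ's pinned Fontaine datum, and has the induced arithmetic-Frobenius polynomial
`∏_(w∣p) P_(ρ,w)(X^f(w∣p))` at almost every `p` (conditional a.e. rendering through the
Satake avatars `β`). [cite: SerreAbelianLadic1968, Ch. I §2.3] [cite: FontaineAsterisque223III, §3] -/
theorem stub_induceGeometric : ∀ (F : Type) [Field F] [NumberField F] (n : ℕ), 0 < n → ∀ (ℓ : ℕ) [Fact ℓ.Prime] (ι : PadicAlgCl ℓ ≃+* ℂ) (ρ : Literature.NumberTheory.GaloisRepresentations.FramedGaloisRep F (PadicAlgCl ℓ) n), ρ.toGaloisRep.IsIrreducible → (∀ᶠ w : IsDedekindDomain.HeightOneSpectrum (NumberField.RingOfIntegers F) in cofinite, ρ.IsUnramifiedAt w) → (∀ (w : IsDedekindDomain.HeightOneSpectrum (NumberField.RingOfIntegers F)) (hw : ((ℓ : ℕ) : NumberField.RingOfIntegers F) ∈ w.asIdeal), (Literature.NumberTheory.PAdicHodge.fontainePstAdicCompletion w ℓ hw).IsDeRhamFramed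 (ρ.toLocal w)) → ∃ R : Literature.NumberTheory.GaloisRepresentations.FramedGaloisRep ℚ (PadicAlgCl ℓ) (n * Module.finrank ℚ F), R.toGaloisRep.IsSemisimple ∧ (∀ᶠ v : IsDedekindDomain.HeightOneSpectrum (NumberField.RingOfIntegers ℚ) in cofinite, R.IsUnramifiedAt v) ∧ (∀ (v : IsDedekindDomain.HeightOneSpectrum (NumberField.RingOfIntegers ℚ)) (hv : ((ℓ : ℕ) : NumberField.RingOfIntegers ℚ) ∈ v.asIdeal), (Literature.NumberTheory.PAdicHodge.fontainePstAdicCompletion v ℓ hv).IsDeRhamFramed (R.toLocal v)) ∧ ∀ᶠ v : IsDedekindDomain.HeightOneSpectrum (NumberField.RingOfIntegers ℚ) in cofinite, ∀ β : IsDedekindDomain.HeightOneSpectrum (NumberField.RingOfIntegers F) → Multiset ℂ, (∀ w : IsDedekindDomain.HeightOneSpectrum (NumberField.RingOfIntegers F), w.asIdeal.under (NumberField.RingOfIntegers ℚ) = v.asIdeal → ρ.IsUnramifiedAt w ∧ ρ.HasFrobCharpolyAt w (Literature.NumberTheory.Automorphic.arithFrobPolyOfSatake ι w.residueCard 1 (β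 w))) → R.HasFrobCharpolyAt v (∏ᶠ w ∈ {w : IsDedekindDomain.HeightOneSpectrum (NumberField.RingOfIntegers F) | w.asIdeal.under (NumberField.RingOfIntegers ℚ) = v.asIdeal}, (Literature.NumberTheory.Automorphic.arithFrobPolyOfSatake ι w.residueCard 1 (β w)).comp (Polynomial.X ^ w.asIdeal.inertiaDeg (NumberField.RingOfIntegers ℚ))) := by
  sorry

/-- **stub_automorphiseSemisimple** (L, consumes `LanglandsOverQ`): a semisimple geometric
`R : Γ_ℚ → GL_N(ℚ̄_ℓ)` is weakly automorphic with L-algebraic output — (B)_ℚ on its irreducible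
(geometric) constituents and the isobaric sum (Langlands 1979, Prop. 2; Jacquet–Shalika 1981).
[cite: LanglandsCorvallis1979Notion, Prop. 2] [cite: JacquetShalikaAJM1981II, Thm. 4.4] -/
theorem stub_automorphiseSemisimple : LanglandsOverQ → ∀ (N : ℕ), 0 < N → ∀ (ℓ : ℕ) [Fact ℓ.Prime] (ι : PadicAlgCl ℓ ≃+* ℂ) (R : Literature.NumberTheory.GaloisRepresentations.FramedGaloisRep ℚ (PadicAlgCl ℓ) N), R.toGaloisRep.IsSemisimple → (∀ᶠ v : IsDedekindDomain.HeightOneSpectrum (NumberField.RingOfIntegers ℚ) in cofinite, R.IsUnramifiedAt v) → (∀ (v : IsDedekindDomain.HeightOneSpectrum (NumberField.RingOfIntegers ℚ)) (hv : ((ℓ : ℕ) : NumberField.RingOfIntegers ℚ) ∈ v.asIdeal), (Literature.NumberTheory.PAdicHodge.fontainePstAdicCompletion v ℓ hv).IsDeRhamFramed (R.toLocal v)) → ∃ (hQ : Literature.NumberTheory.Automorphic.isCompact_glFiniteIntegralLevel N ℚ) (P : Literature.NumberTheory.Automorphic.AutomorphicRepData (Literature.NumberTheory.Automorphic.AutomorphyDatum.gl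 N ℚ hQ)), P.IsLAlgebraic ∧ ∀ᶠ v : IsDedekindDomain.HeightOneSpectrum (NumberField.RingOfIntegers ℚ) in cofinite, ∀ Q : Polynomial (PadicAlgCl ℓ), R.IsUnramifiedAt v → R.HasFrobCharpolyAt v Q → ∃ α : Multiset ℂ, P.HasSatakeParamAt v α ∧ Literature.NumberTheory.Automorphic.arithFrobPolyOfSatake ι v.residueCard 1 α = Q := by
  sorry

/-- **stub_dictionary** (M, pure algebra): the dictionary `a ↦ ι⁻¹(a⁻¹)` between Satake parameters
and arithmetic-Frobenius roots (`arithFrobPolyOfSatake ι q 1`) is a bijection `ℂ → ℚ̄_ℓ` commuting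
with `f`-th powers, so the induced-product identity transfers from the Frobenius side to the Satake
side. [cite: BuzzardGeeLMS2014, §2.1 and Rem. 3.2.5] -/
theorem stub_dictionary : ∀ (F : Type) [Field F] [NumberField F] (ℓ : ℕ) [Fact ℓ.Prime] (ι : PadicAlgCl ℓ ≃+* ℂ) (v : IsDedekindDomain.HeightOneSpectrum (NumberField.RingOfIntegers ℚ)) (β : IsDedekindDomain.HeightOneSpectrum (NumberField.RingOfIntegers F) → Multiset ℂ) (α : Multiset ℂ), Literature.NumberTheory.Automorphic.arithFrobPolyOfSatake ι v.residueCard 1 α = (∏ᶠ w ∈ {w : IsDedekindDomain.HeightOneSpectrum (NumberField.RingOfIntegers F) | w.asIdeal.under (NumberField.RingOfIntegers ℚ) = v.asIdeal}, (Literature.NumberTheory.Automorphic.arithFrobPolyOfSatake ι w.residueCard 1 (β w)).comp (Polynomial.X ^ w.asIdeal.inertiaDeg (NumberField.RingOfIntegers ℚ))) → Literature.NumberTheory.Automorphic.satakePolynomial α = ∏ᶠ w ∈ {w : IsDedekindDomain.HeightOneSpectrum (NumberField.RingOfIntegers F) | w.asIdeal.under (NumberField.RingOfIntegers ℚ) =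 v.asIdeal}, (Literature.NumberTheory.Automorphic.satakePolynomial (β w)).comp (Polynomial.X ^ w.asIdeal.inertiaDeg (NumberField.RingOfIntegers ℚ)) := by
  sorry

/-- **Composition**: the three stubs give the piece. [folklore] -/
theorem InducedAutomorphyOverQ_of : (∀ (F : Type) [Field F] [NumberField F] (n : ℕ), 0 < n → ∀ (ℓ : ℕ) [Fact ℓ.Prime] (ι : PadicAlgCl ℓ ≃+* ℂ) (ρ : Literature.NumberTheory.GaloisRepresentations.FramedGaloisRep F (PadicAlgCl ℓ) n), ρ.toGaloisRep.IsIrreducible → (∀ᶠ w : IsDedekindDomain.HeightOneSpectrum (NumberField.RingOfIntegers F) in cofinite, ρ.IsUnramifiedAt w) → (∀ (w : IsDedekindDomain.HeightOneSpectrum (NumberField.RingOfIntegers F)) (hw : ((ℓ : ℕ) : NumberField.RingOfIntegers F) ∈ w.asIdeal), (Literature.NumberTheory.PAdicHodge.fontainePstAdicCompletion w ℓ hw).IsDeRhamFramed (ρ.toLocal w)) → ∃ R : Literature.NumberTheory.GaloisRepresentations.FramedGaloisRep ℚ (PadicAlgCl ℓ) (n * Module.finrank ℚ F), R.toGaloisRep.IsSemisimple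 ∧ (∀ᶠ v : IsDedekindDomain.HeightOneSpectrum (NumberField.RingOfIntegers ℚ) in cofinite, R.IsUnramifiedAt v) ∧ (∀ (v : IsDedekindDomain.HeightOneSpectrum (NumberField.RingOfIntegers ℚ)) (hv : ((ℓ : ℕ) : NumberField.RingOfIntegers ℚ) ∈ v.asIdeal), (Literature.NumberTheory.PAdicHodge.fontainePstAdicCompletion v ℓ hv).IsDeRhamFramed (R.toLocal v)) ∧ ∀ᶠ v : IsDedekindDomain.HeightOneSpectrum (NumberField.RingOfIntegers ℚ) in cofinite, ∀ β : IsDedekindDomain.HeightOneSpectrum (NumberField.RingOfIntegers F) → Multiset ℂ, (∀ w : IsDedekindDomain.HeightOneSpectrum (NumberField.RingOfIntegers F), w.asIdeal.under (NumberField.RingOfIntegers ℚ) = v.asIdeal → ρ.IsUnramifiedAt w ∧ ρ.HasFrobCharpolyAt w (Literature.NumberTheory.Automorphic.arithFrobPolyOfSatake ι w.residueCard 1 (β w))) → R.HasFrobCharpolyAt v (∏ᶠ w ∈ {w : IsDedekindDomain.HeightOneSpectrum (NumberField.RingOfIntegers F) | w.asIdeal.under (NumberField.RingOfIntegers ℚ)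 = v.asIdeal}, (Literature.NumberTheory.Automorphic.arithFrobPolyOfSatake ι w.residueCard 1 (β w)).comp (Polynomial.X ^ w.asIdeal.inertiaDeg (NumberField.RingOfIntegers ℚ)))) → (LanglandsOverQ → ∀ (N : ℕ), 0 < N → ∀ (ℓ : ℕ) [Fact ℓ.Prime] (ι : PadicAlgCl ℓ ≃+* ℂ) (R : Literature.NumberTheory.GaloisRepresentations.FramedGaloisRep ℚ (PadicAlgCl ℓ) N), R.toGaloisRep.IsSemisimple → (∀ᶠ v : IsDedekindDomain.HeightOneSpectrum (NumberField.RingOfIntegers ℚ) in cofinite, R.IsUnramifiedAt v) → (∀ (v : IsDedekindDomain.HeightOneSpectrum (NumberField.RingOfIntegers ℚ)) (hv : ((ℓ : ℕ) : NumberField.RingOfIntegers ℚ) ∈ v.asIdeal), (Literature.NumberTheory.PAdicHodge.fontainePstAdicCompletion v ℓ hv).IsDeRhamFramed (R.toLocal v)) → ∃ (hQ : Literature.NumberTheory.Automorphic.isCompact_glFiniteIntegralLevel N ℚ) (P : Literature.NumberTheory.Automorphic.AutomorphicRepData (Literature.NumberTheory.Automorphic.AutomorphyDatum.gl N ℚ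 hQ)), P.IsLAlgebraic ∧ ∀ᶠ v : IsDedekindDomain.HeightOneSpectrum (NumberField.RingOfIntegers ℚ) in cofinite, ∀ Q : Polynomial (PadicAlgCl ℓ), R.IsUnramifiedAt v → R.HasFrobCharpolyAt v Q → ∃ α : Multiset ℂ, P.HasSatakeParamAt v α ∧ Literature.NumberTheory.Automorphic.arithFrobPolyOfSatake ι v.residueCard 1 α = Q) → (∀ (F : Type) [Field F] [NumberField F] (ℓ : ℕ) [Fact ℓ.Prime] (ι : PadicAlgCl ℓ ≃+* ℂ) (v : IsDedekindDomain.HeightOneSpectrum (NumberField.RingOfIntegers ℚ)) (β : IsDedekindDomain.HeightOneSpectrum (NumberField.RingOfIntegers F) → Multiset ℂ) (α : Multiset ℂ), Literature.NumberTheory.Automorphic.arithFrobPolyOfSatake ι v.residueCard 1 α = (∏ᶠ w ∈ {w : IsDedekindDomain.HeightOneSpectrum (NumberField.RingOfIntegers F) | w.asIdeal.under (NumberField.RingOfIntegers ℚ) = v.asIdeal}, (Literature.NumberTheory.Automorphic.arithFrobPolyOfSatake ι w.residueCard 1 (β w)).comp (Polynomial.X ^ w.asIdeal.inertiaDeg (NumberField.RingOfIntegers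 ℚ))) → Literature.NumberTheory.Automorphic.satakePolynomial α = ∏ᶠ w ∈ {w : IsDedekindDomain.HeightOneSpectrum (NumberField.RingOfIntegers F) | w.asIdeal.under (NumberField.RingOfIntegers ℚ) = v.asIdeal}, (Literature.NumberTheory.Automorphic.satakePolynomial (β w)).comp (Polynomial.X ^ w.asIdeal.inertiaDeg (NumberField.RingOfIntegers ℚ))) → InducedAutomorphyOverQ := by
  intro h1 h2 h3 hQ F _ _ n hn ℓ _ ι ρ hirr hunr hdR
  obtain ⟨R, hss, hRunr, hRdR, hRfrob⟩ := h1 F n hn ℓ ι ρ hirr hunr hdR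
  have hN : 0 < n * Module.finrank ℚ F := Nat.mul_pos hn Module.finrank_pos
  obtain ⟨hQ', P, hPalg, hP⟩ := h2 hQ (n * Module.finrank ℚ F) hN ℓ ι R hss hRunr hRdR
  refine ⟨hQ', P, hPalg, ?_⟩
  filter_upwards [hRunr, hRfrob, hP] with v hv1 hv2 hv3
  intro β hβ
  obtain ⟨α, hα, hαQ⟩ := hv3 _ hv1 (hv2 β hβ)
  exact ⟨α, hα, h3 F ℓ ι v β α hαQ⟩

end Summit.Langlands.Langlands.Cruxes.AJunction.BirthInducedAutomorphyOverQ
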